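import Summits.CriticalPhenomena.PercolationContinuityZ3.Theorems.PercNearOneGluingNoHeavyLowerTailTformStarPackingDeficit
import HarnessLib

/-!
# `NoHeavyLowerTail` (stmt-CriticalPhenomena-4575) — the star-packing transfer for a GLUED SET: peeling one member of the set

Support file (prover `prim-hp-5`, hull-port cell, T-form calculus, gen 7; `--supports stmt-CriticalPhenomena-4575`).  No definitions,
no named facts, no sorries.  `μ = prodBernoulli w` on `Fin n`, relays `A`, level `j`; a non-relay vertex `o` (the PEELED member), a finset
`B'` of further non-relay vertices (`o ∉ B'`), `B = insert o B'` (the glued set); `N_B = |π(B)| = |⋃_{m ∈ B} π(m)|`, `N_v = |π(v)|`;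
`K = G − o` read on `ω ∩ {e | o ∉ e}` (`R'`, `N'`).  GLUED LIGHTNESS of a relay `x` at `B`:
`G_x = {x ~ B → N_B ≤ j} ∩ {x ≁ B → N_x ≤ j}` ("`x` is light in `w/B`"; `μ(G_x) = μ(x ≁ B, N_x ≤ j) + μ(x ~ B, N_B ≤ j)`).

`Theorems.starPacking_deficit` is the case `B' = ∅`: it decomposes along the star of the observer `o`.  Here the same decomposition is run
for an observer-PIECE `o` of a glued set: on the star event `σ_S` (exactly the gates `S` of `o` open) the cluster of the glued set `B` in `w`
is the cluster of the glued set `B' ∪ S` in `K` (dictionary `∃ m ∈ B, m ↔ z  ⟺  ∃ m' ∈ B' ∪ S, m' ↔' z`), so the packing inequality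
LSP(K, p, c, B' ∪ S) at EVERY star `S` (including `S = ∅`, where for `B' = ∅` it reads `Φ_K(c) ≤ Φ_K(p)`) transfers to
    `μ(1 ≤ N_B ≤ j) + μ(N_c ≤ j) ≤ μ(N_c ≤ j, 1 ≤ N_B) + μ(G_p)`,
i.e. `θ_c(w/B) ≤ Φ_{w/B}(p)`: every reference `p` that is a T-witness of every glued star of `K = w − o` extended by `B'` is admissible for the
glued observer `B` of `w` (seat memo OBSERVER-SET.md §18 'PT-ADM': e.g. every champion of `w − o`, by the set induction `lspSet_induction_open`).

* `gluedStarPacking_deficit` — the transfer;  `gluedSet_lsp_of_reference` — the light-star packing inequality LSP(w, x, c, B) for every relay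
  `x` at least as light in `w/B` as such a reference (`μ(G_p) ≤ μ(G_x)`).
-/

noncomputable section

namespace Summit.CriticalPhenomena.PercolationContinuityZ3.Theorems

open MeasureTheory Set Literature.Probability.LatticeModels Literature.Probability.Percolation
open scoped Classical BigOperators

variable {n : ℕ}

open CutObserver KNPreFKG in
/-- **STAR-PACKING TRANSFER FOR A GLUED SET (peeling one member), DEFICIT FORM.**  Let `o ∉ A`, `o ∉ B'`, `p, c ∈ A`,
and suppose that for EVERY set `S` of positive-weight neighbours of `o` (including `S = ∅`) the packing inequality for the set `B' ∪ S`
`μ(p ≁' B' ∪ S, 1 ≤ |π'(B' ∪ S)| ≤ j) + μ(|π'(B' ∪ S)| = 0, |π'(c)| ≤ j) ≤ μ(p ≁' B' ∪ S, |π'(p)| ≤ j)` holds (events of the configuration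
off `o`).  Then, with `B = insert o B'` glued, `μ{1 ≤ N_B ≤ j} + μ{N_c ≤ j} ≤ μ{N_c ≤ j, 1 ≤ N_B} + μ(G_p)`.
[cite: KozmaNitzan2024, Lemma 5 and Thm. 4 (pp. 13–14) — star decomposition] -/
theorem gluedStarPacking_deficit (w : Sym2 (Fin n) → unitInterval) (A B' : Finset (Fin n)) (o p c : Fin n) (j : ℕ)
    (hoA : o ∉ A) (hpA : p ∈ A) (hcA : c ∈ A) (hoB' : o ∉ B')
    (hPST : ∀ S : Finset (Fin n), (∀ y ∈ S, y ≠ o ∧ w s(o, y) ≠ 0) →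
      (prodBernoulli w).real {ω : BondConfig (Fin n) |
          (∀ m ∈ B' ∪ S, ¬ (openGraph (ω ∩ {e | o ∉ e})).Reachable p m) ∧
            1 ≤ (A.filter fun z => ∃ m ∈ B' ∪ S, (openGraph (ω ∩ {e | o ∉ e})).Reachable m z).card ∧
            (A.filter fun z => ∃ m ∈ B' ∪ S, (openGraph (ω ∩ {e | o ∉ e})).Reachable m z).card ≤ j} +
        (prodBernoulli w).real {ω : BondConfig (Fin n) |
          ¬ 1 ≤ (A.filter fun z => ∃ m ∈ B' ∪ S, (openGraph (ω ∩ {e | o ∉ e})).Reachable m z).card ∧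
            (A.filter fun z => (openGraph (ω ∩ {e | o ∉ e})).Reachable c z).card ≤ j} ≤
      (prodBernoulli w).real {ω : BondConfig (Fin n) |
          (∀ m ∈ B' ∪ S, ¬ (openGraph (ω ∩ {e | o ∉ e})).Reachable p m) ∧
            (A.filter fun z => (openGraph (ω ∩ {e | o ∉ e})).Reachable p z).card ≤ j}) :
    (prodBernoulli w).real {ω : BondConfig (Fin n) |
        1 ≤ (A.filter fun z => ∃ m ∈ insert o B', ω ∈ openConn m z).card ∧
          (A.filter fun z => ∃ m ∈ insert o B', ω ∈ openConn m z).card ≤ j} +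
      (prodBernoulli w).real {ω : BondConfig (Fin n) | (A.filter fun z => ω ∈ openConn c z).card ≤ j} ≤
      (prodBernoulli w).real {ω : BondConfig (Fin n) |
        (A.filter fun z => ω ∈ openConn c z).card ≤ j ∧ 1 ≤ (A.filter fun z => ∃ m ∈ insert o B', ω ∈ openConn m z).card} +
      (prodBernoulli w).real {ω : BondConfig (Fin n) |
        ((∃ m ∈ insert o B', ω ∈ openConn p m) → (A.filter fun z => ∃ m ∈ insert o B', ω ∈ openConn m z).card ≤ j) ∧
          ((∀ m ∈ insert o B', ω ∉ openConn p m) → (A.filter fun z => ω ∈ openConn p z).card ≤ j)} := by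
  haveI : IsProbabilityMeasure (prodBernoulli w) := inferInstance
  set μ := prodBernoulli w with hμ
  have hpo : p ≠ o := fun h => hoA (h ▸ hpA)
  have hco : c ≠ o := fun h => hoA (h ▸ hcA)
  set B : Finset (Fin n) := insert o B' with hB
  set R' : BondConfig (Fin n) → Fin n → Fin n → Prop := fun ω x y =>
    (openGraph (ω ∩ {e | o ∉ e})).Reachable x y with hR'
  -- events
  set NB : BondConfig (Fin n) → ℕ := fun ω => (A.filter fun z => ∃ m ∈ B, ω ∈ openConn m z).card with hNB
  set L := {ω : BondConfig (Fin n) | 1 ≤ NB ω ∧ NB ω ≤ j} with hL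
  set Att := {ω : BondConfig (Fin n) | 1 ≤ NB ω} with hAtt
  set RcA := {ω : BondConfig (Fin n) | (A.filter fun z => ω ∈ openConn c z).card ≤ j ∧ 1 ≤ NB ω} with hRcA
  set Rc := {ω : BondConfig (Fin n) | (A.filter fun z => ω ∈ openConn c z).card ≤ j} with hRc
  set V := {ω : BondConfig (Fin n) | ∃ m ∈ B, ω ∈ openConn p m} with hV
  set Gp := {ω : BondConfig (Fin n) | ((∃ m ∈ B, ω ∈ openConn p m) → NB ω ≤ j) ∧
    ((∀ m ∈ B, ω ∉ openConn p m) → (A.filter fun z => ω ∈ openConn p z).card ≤ j)} with hGp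
  change μ.real L + μ.real Rc ≤ μ.real RcA + μ.real Gp
  -- gates of `o`
  set Γ : Finset (Fin n) := Finset.univ.filter fun v => v ≠ o ∧ w s(o, v) ≠ 0 with hΓ
  have hΓo : o ∉ Γ := by
    rw [hΓ, Finset.mem_filter]; exact fun h => h.2.1 rfl
  have hiso : ∀ v, v ≠ o → v ∉ Γ → w s(o, v) = 0 := by
    intro v hvo hvΓ
    by_contra hne
    exact hvΓ (Finset.mem_filter.2 ⟨Finset.mem_univ _, hvo, hne⟩)
  have hoB : o ∈ B := Finset.mem_insert_self o B'
  have hB'B : ∀ m ∈ B', m ∈ B := fun m hm => Finset.mem_insert_of_mem hm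
  have hB'o : ∀ m ∈ B', m ≠ o := fun m hm h => hoB' (h ▸ hm)
  -- ### the per-star inequality
  have hstar : ∀ S ∈ Γ.powerset,
      μ.real (L ∩ starEvent o ↑S) ≤
        μ.real (RcA ∩ starEvent o ↑S) + (μ.real (Gp ∩ starEvent o ↑S) - μ.real (Rc ∩ starEvent o ↑S)) := by
    intro S hS
    have hSΓ : S ⊆ Γ := Finset.mem_powerset.1 hS
    have hSo : ∀ y ∈ S, y ≠ o := fun y hy => (Finset.mem_filter.1 (hSΓ hy)).2.1
    have hpack := hPST S fun y hy => ⟨hSo y hy, (Finset.mem_filter.1 (hSΓ hy)).2.2⟩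
    set σ := starEvent o (↑S : Set (Fin n)) with hσdef
    -- the three `K`-events
    set P1 : BondConfig (Fin n) → Prop := fun ξ =>
      (∀ m ∈ B' ∪ S, ¬ (openGraph ξ).Reachable p m) ∧
        1 ≤ (A.filter fun z => ∃ m ∈ B' ∪ S, (openGraph ξ).Reachable m z).card ∧
        (A.filter fun z => ∃ m ∈ B' ∪ S, (openGraph ξ).Reachable m z).card ≤ j with hP1
    set P2 : BondConfig (Fin n) → Prop := fun ξ =>
      ¬ 1 ≤ (A.filter fun z => ∃ m ∈ B' ∪ S, (openGraph ξ).Reachable m z).card ∧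
        (A.filter fun z => (openGraph ξ).Reachable c z).card ≤ j with hP2
    set P3 : BondConfig (Fin n) → Prop := fun ξ =>
      (∀ m ∈ B' ∪ S, ¬ (openGraph ξ).Reachable p m) ∧ (A.filter fun z => (openGraph ξ).Reachable p z).card ≤ j with hP3
    change μ.real {ω | P1 (ω ∩ {e | o ∉ e})} + μ.real {ω | P2 (ω ∩ {e | o ∉ e})} ≤
      μ.real {ω | P3 (ω ∩ {e | o ∉ e})} at hpack
    -- DICTIONARY: on σ, the relays joined to the glued set `B` in `w` are those joined to `B' ∪ S` off `o`
    have hD : ∀ ω ∈ σ, ∀ z, z ≠ o → ((∃ m ∈ B, ω ∈ openConn m z) ↔ (∃ m' ∈ B' ∪ S, R' ω m' z)) := by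
      intro ω hω z hzo
      constructor
      · rintro ⟨m, hm, hmz⟩
        have hmz' : (openGraph ω).Reachable m z := hmz
        rcases Finset.mem_insert.1 hm with rfl | hmB'
        · obtain ⟨y, hy, hyz⟩ := exists_avoid_of_reachable_star hω hzo hmz'
          exact ⟨y, Finset.mem_union_right _ (Finset.mem_coe.1 hy), hyz⟩
        · by_cases hmo : (openGraph ω).Reachable m o
          · obtain ⟨y, hy, hyz⟩ := exists_avoid_of_reachable_star hω hzo (hmo.symm.trans hmz')
            exact ⟨y, Finset.mem_union_right _ (Finset.mem_coe.1 hy), hyz⟩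
          · exact ⟨m, Finset.mem_union_left _ hmB', reachable_avoiding_of_not_reachable hmo hmz'⟩
      · rintro ⟨m', hm', hmz⟩
        rcases Finset.mem_union.1 hm' with hmB' | hmS
        · exact ⟨m', hB'B m' hmB', reachable_mono inter_subset_left hmz⟩
        · exact ⟨o, hoB, reachable_of_mem_star hω (hSo m' hmS) (Finset.mem_coe.2 hmS) hmz⟩
    have hF3 : ∀ ω ∈ σ, (A.filter fun z => ∃ m ∈ B, ω ∈ openConn m z) =
        (A.filter fun z => ∃ m' ∈ B' ∪ S, R' ω m' z) := by
      intro ω hω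
      refine Finset.filter_congr fun z hz => ?_
      exact hD ω hω z (fun h => hoA (h ▸ hz))
    -- off V: π(p) = π'(p), p ≁' B' ∪ S; on σ: p ≁' B' ∪ S ⇒ p ∉ V
    have hVo : ∀ ω, ω ∉ V → ¬ (openGraph ω).Reachable p o := by
      intro ω hVω h
      exact hVω ⟨o, hoB, h⟩
    have hF4a : ∀ ω, ω ∉ V → (A.filter fun x => ω ∈ openConn p x) = (A.filter fun z => R' ω p z) := by
      intro ω hVω
      refine Finset.filter_congr fun x _ => ⟨fun h => ?_, fun h => reachable_mono inter_subset_left h⟩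
      exact reachable_avoiding_of_not_reachable (hVo ω hVω) h
    have hF4b : ∀ ω ∈ σ, ω ∉ V → ∀ m' ∈ B' ∪ S, ¬ R' ω p m' := by
      intro ω hω hVω m' hm' hpm
      rcases Finset.mem_union.1 hm' with hmB' | hmS
      · exact hVω ⟨m', hB'B m' hmB', reachable_mono inter_subset_left hpm⟩
      · exact hVo ω hVω ((reachable_of_mem_star hω (hSo m' hmS) (Finset.mem_coe.2 hmS) hpm.symm).symm)
    have hF5 : ∀ ω ∈ σ, (∀ m' ∈ B' ∪ S, ¬ R' ω p m') → ω ∉ V := by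
      intro ω hω hny hVω
      obtain ⟨m, hm, hpm⟩ := hVω
      have hpm' : (openGraph ω).Reachable p m := hpm
      have hpo' : ¬ (openGraph ω).Reachable p o := by
        intro h
        obtain ⟨y, hy, hyp⟩ := exists_avoid_of_reachable_star hω hpo h.symm
        exact hny y (Finset.mem_union_right _ (Finset.mem_coe.1 hy)) hyp.symm
      rcases Finset.mem_insert.1 hm with rfl | hmB'
      · exact hpo' hpm'
      · exact hny m (Finset.mem_union_left _ hmB') (reachable_avoiding_of_not_reachable hpo' hpm')
    -- (a) L ∩ σ ∩ V ⊆ Gp ∩ σ ∩ V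
    have ha : L ∩ σ ∩ V ⊆ Gp ∩ σ ∩ V := by
      rintro ω ⟨⟨hLω, hω⟩, hVω⟩
      refine ⟨⟨⟨fun _ => hLω.2, fun hnot => ?_⟩, hω⟩, hVω⟩
      obtain ⟨m, hm, hpm⟩ := hVω
      exact absurd hpm (hnot m hm)
    -- (b) (L ∩ σ) \ V ⊆ σ ∩ {P1}
    have hb : (L ∩ σ) \ V ⊆ σ ∩ {ω | P1 (ω ∩ {e | o ∉ e})} := by
      rintro ω ⟨⟨hLω, hω⟩, hVω⟩
      refine ⟨hω, ?_⟩
      show P1 (ω ∩ {e | o ∉ e})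
      refine ⟨hF4b ω hω hVω, ?_, ?_⟩
      · have := hLω.1; simp only [hNB] at this; rw [hF3 ω hω] at this; exact this
      · have := hLω.2; simp only [hNB] at this; rw [hF3 ω hω] at this; exact this
    -- (b') (Rc ∩ σ) \ Att ⊆ σ ∩ {P2}
    have hb' : (Rc ∩ σ) \ Att ⊆ σ ∩ {ω | P2 (ω ∩ {e | o ∉ e})} := by
      rintro ω ⟨⟨hRω, hω⟩, hA⟩
      refine ⟨hω, ?_⟩
      show P2 (ω ∩ {e | o ∉ e})
      have hA' : ¬ 1 ≤ NB ω := hA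
      refine ⟨by simp only [hNB] at hA'; rw [hF3 ω hω] at hA'; exact hA', ?_⟩
      -- `c` is a relay not joined to `o` (else `N_B ≥ 1`), so its cluster avoids `o`
      have hco' : ¬ (openGraph ω).Reachable c o := by
        intro h
        exact hA' (Finset.card_pos.2 ⟨c, Finset.mem_filter.2 ⟨hcA, o, hoB, (show ω ∈ openConn o c from h.symm)⟩⟩)
      have heq : (A.filter fun z => ω ∈ openConn c z) = (A.filter fun z => R' ω c z) := by
        refine Finset.filter_congr fun x _ => ⟨fun h => ?_, fun h => reachable_mono inter_subset_left h⟩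
        exact reachable_avoiding_of_not_reachable hco' h
      have h := hRω
      change (A.filter fun z => ω ∈ openConn c z).card ≤ j at h
      rw [heq] at h; exact h
    -- (c) σ ∩ {P3} ⊆ (Gp ∩ σ) \ V
    have hc : σ ∩ {ω | P3 (ω ∩ {e | o ∉ e})} ⊆ (Gp ∩ σ) \ V := by
      rintro ω ⟨hω, hRω⟩
      change P3 (ω ∩ {e | o ∉ e}) at hRω
      obtain ⟨hny, hcard⟩ := hRω
      have hVω : ω ∉ V := hF5 ω hω hny
      refine ⟨⟨⟨fun hV' => absurd hV' hVω, fun _ => ?_⟩, hω⟩, hVω⟩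
      rw [hF4a ω hVω]; exact hcard
    -- (d) independence of the star
    have hd1 : μ.real (σ ∩ {ω | P1 (ω ∩ {e | o ∉ e})}) = μ.real σ * μ.real {ω | P1 (ω ∩ {e | o ∉ e})} :=
      measureReal_starEvent_inter_avoid w o ↑S P1
    have hd2 : μ.real (σ ∩ {ω | P2 (ω ∩ {e | o ∉ e})}) = μ.real σ * μ.real {ω | P2 (ω ∩ {e | o ∉ e})} :=
      measureReal_starEvent_inter_avoid w o ↑S P2
    have hd3 : μ.real (σ ∩ {ω | P3 (ω ∩ {e | o ∉ e})}) = μ.real σ * μ.real {ω | P3 (ω ∩ {e | o ∉ e})} :=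
      measureReal_starEvent_inter_avoid w o ↑S P3
    -- assemble
    have hsplitL := measureReal_inter_add_sdiff (μ := μ) (s := L ∩ σ) (MeasurableSet.of_discrete (s := V))
      (measure_ne_top _ _)
    have hsplitR := measureReal_inter_add_sdiff (μ := μ) (s := Gp ∩ σ) (MeasurableSet.of_discrete (s := V))
      (measure_ne_top _ _)
    have hsplitC := measureReal_inter_add_sdiff (μ := μ) (s := Rc ∩ σ) (MeasurableSet.of_discrete (s := Att))
      (measure_ne_top _ _)
    have hRcA' : Rc ∩ σ ∩ Att = RcA ∩ σ := by
      ext ω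
      simp only [hRc, hRcA, hAtt, mem_inter_iff, mem_setOf_eq]
      constructor
      · rintro ⟨⟨h1, h2⟩, h3⟩; exact ⟨⟨h1, h3⟩, h2⟩
      · rintro ⟨⟨h1, h3⟩, h2⟩; exact ⟨⟨h1, h2⟩, h3⟩
    rw [hRcA'] at hsplitC
    have h1 : μ.real (L ∩ σ ∩ V) ≤ μ.real (Gp ∩ σ ∩ V) := measureReal_mono ha (measure_ne_top _ _)
    have h2 : μ.real ((L ∩ σ) \ V) ≤ μ.real σ * μ.real {ω | P1 (ω ∩ {e | o ∉ e})} := by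
      rw [← hd1]; exact measureReal_mono hb (measure_ne_top _ _)
    have h2' : μ.real ((Rc ∩ σ) \ Att) ≤ μ.real σ * μ.real {ω | P2 (ω ∩ {e | o ∉ e})} := by
      rw [← hd2]; exact measureReal_mono hb' (measure_ne_top _ _)
    have h3 : μ.real σ * μ.real {ω | P3 (ω ∩ {e | o ∉ e})} ≤ μ.real ((Gp ∩ σ) \ V) := by
      rw [← hd3]; exact measureReal_mono hc (measure_ne_top _ _)
    have h4 : μ.real σ * (μ.real {ω | P1 (ω ∩ {e | o ∉ e})} + μ.real {ω | P2 (ω ∩ {e | o ∉ e})}) ≤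
        μ.real σ * μ.real {ω | P3 (ω ∩ {e | o ∉ e})} :=
      mul_le_mul_of_nonneg_left hpack measureReal_nonneg
    have hLsum : μ.real (L ∩ σ) = μ.real (L ∩ σ ∩ V) + μ.real ((L ∩ σ) \ V) := hsplitL.symm
    have hRsum : μ.real (Gp ∩ σ) = μ.real (Gp ∩ σ ∩ V) + μ.real ((Gp ∩ σ) \ V) := hsplitR.symm
    nlinarith [hsplitC, measureReal_nonneg (μ := μ) (s := σ)]
  -- ### summing over the stars
  have hdecL := real_eq_sum_inter_starEvent w Γ o hΓo hiso L
  have hdecA := real_eq_sum_inter_starEvent w Γ o hΓo hiso RcA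
  have hdecp := real_eq_sum_inter_starEvent w Γ o hΓo hiso Gp
  have hdecc := real_eq_sum_inter_starEvent w Γ o hΓo hiso Rc
  have hsum : ∑ S ∈ Γ.powerset, μ.real (L ∩ starEvent o ↑S) ≤
      ∑ S ∈ Γ.powerset, (μ.real (RcA ∩ starEvent o ↑S) +
        (μ.real (Gp ∩ starEvent o ↑S) - μ.real (Rc ∩ starEvent o ↑S))) := Finset.sum_le_sum hstar
  rw [Finset.sum_add_distrib, Finset.sum_sub_distrib, ← hdecL, ← hdecA, ← hdecp, ← hdecc] at hsum
  linarith


/-- **Light-star packing at a glued set from a starwise-admissible reference.**  In the setting of `gluedStarPacking_deficit`, every relay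
`x` that is at least as light in `w/B` as the reference `p` (`μ(G_p) ≤ μ(G_x)`) is a T-witness of the glued set `B = insert o B'`:
`μ(x ≁ B, 1 ≤ N_B ≤ j) + μ(N_B = 0, N_c ≤ j) ≤ μ(x ≁ B, N_x ≤ j)`.  (On `{x ~ B}` the events `{1 ≤ N_B ≤ j}` and `G_x` coincide.)
[cite: KozmaNitzan2024, Lemma 5 and Thm. 4 (pp. 13–14)] -/
theorem gluedSet_lsp_of_reference (w : Sym2 (Fin n) → unitInterval) (A B' : Finset (Fin n)) (o p x c : Fin n) (j : ℕ)
    (hoA : o ∉ A) (hpA : p ∈ A) (hxA : x ∈ A) (hcA : c ∈ A) (hoB' : o ∉ B')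
    (hPST : ∀ S : Finset (Fin n), (∀ y ∈ S, y ≠ o ∧ w s(o, y) ≠ 0) →
      (prodBernoulli w).real {ω : BondConfig (Fin n) |
          (∀ m ∈ B' ∪ S, ¬ (openGraph (ω ∩ {e | o ∉ e})).Reachable p m) ∧
            1 ≤ (A.filter fun z => ∃ m ∈ B' ∪ S, (openGraph (ω ∩ {e | o ∉ e})).Reachable m z).card ∧
            (A.filter fun z => ∃ m ∈ B' ∪ S, (openGraph (ω ∩ {e | o ∉ e})).Reachable m z).card ≤ j} +
        (prodBernoulli w).real {ω : BondConfig (Fin n) |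
          ¬ 1 ≤ (A.filter fun z => ∃ m ∈ B' ∪ S, (openGraph (ω ∩ {e | o ∉ e})).Reachable m z).card ∧
            (A.filter fun z => (openGraph (ω ∩ {e | o ∉ e})).Reachable c z).card ≤ j} ≤
      (prodBernoulli w).real {ω : BondConfig (Fin n) |
          (∀ m ∈ B' ∪ S, ¬ (openGraph (ω ∩ {e | o ∉ e})).Reachable p m) ∧
            (A.filter fun z => (openGraph (ω ∩ {e | o ∉ e})).Reachable p z).card ≤ j})
    (hcmp : (prodBernoulli w).real {ω : BondConfig (Fin n) |
        ((∃ m ∈ insert o B', ω ∈ openConn p m) → (A.filter fun z => ∃ m ∈ insert o B', ω ∈ openConn m z).card ≤ j) ∧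
          ((∀ m ∈ insert o B', ω ∉ openConn p m) → (A.filter fun z => ω ∈ openConn p z).card ≤ j)} ≤
      (prodBernoulli w).real {ω : BondConfig (Fin n) |
        ((∃ m ∈ insert o B', ω ∈ openConn x m) → (A.filter fun z => ∃ m ∈ insert o B', ω ∈ openConn m z).card ≤ j) ∧
          ((∀ m ∈ insert o B', ω ∉ openConn x m) → (A.filter fun z => ω ∈ openConn x z).card ≤ j)}) :
    (prodBernoulli w).real {ω : BondConfig (Fin n) |
        (∀ m ∈ insert o B', ω ∉ openConn x m) ∧
          1 ≤ (A.filter fun z => ∃ m ∈ insert o B', ω ∈ openConn m z).card ∧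
          (A.filter fun z => ∃ m ∈ insert o B', ω ∈ openConn m z).card ≤ j} +
      (prodBernoulli w).real {ω : BondConfig (Fin n) |
        ¬ 1 ≤ (A.filter fun z => ∃ m ∈ insert o B', ω ∈ openConn m z).card ∧
          (A.filter fun z => ω ∈ openConn c z).card ≤ j} ≤
      (prodBernoulli w).real {ω : BondConfig (Fin n) |
        (∀ m ∈ insert o B', ω ∉ openConn x m) ∧ (A.filter fun z => ω ∈ openConn x z).card ≤ j} := by
  haveI : IsProbabilityMeasure (prodBernoulli w) := inferInstance
  set μ := prodBernoulli w with hμ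
  have hmain := gluedStarPacking_deficit w A B' o p c j hoA hpA hcA hoB' hPST
  set B : Finset (Fin n) := insert o B' with hB
  set NB : BondConfig (Fin n) → ℕ := fun ω => (A.filter fun z => ∃ m ∈ B, ω ∈ openConn m z).card with hNB
  set Nx : BondConfig (Fin n) → ℕ := fun ω => (A.filter fun z => ω ∈ openConn x z).card with hNx
  set Nc : BondConfig (Fin n) → ℕ := fun ω => (A.filter fun z => ω ∈ openConn c z).card with hNc
  set Gx := {ω : BondConfig (Fin n) | ((∃ m ∈ B, ω ∈ openConn x m) → NB ω ≤ j) ∧ ((∀ m ∈ B, ω ∉ openConn x m) → Nx ω ≤ j)}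
    with hGx
  set Vx := {ω : BondConfig (Fin n) | ∃ m ∈ B, ω ∈ openConn x m} with hVx
  change μ.real {ω | 1 ≤ NB ω ∧ NB ω ≤ j} + μ.real {ω | Nc ω ≤ j} ≤ μ.real {ω | Nc ω ≤ j ∧ 1 ≤ NB ω} + _ at hmain
  have hmain' : μ.real {ω | 1 ≤ NB ω ∧ NB ω ≤ j} + μ.real {ω | Nc ω ≤ j} ≤ μ.real {ω | Nc ω ≤ j ∧ 1 ≤ NB ω} + μ.real Gx :=
    le_trans hmain (by linarith [hcmp])
  change μ.real {ω | (∀ m ∈ B, ω ∉ openConn x m) ∧ 1 ≤ NB ω ∧ NB ω ≤ j} + μ.real {ω | ¬ 1 ≤ NB ω ∧ Nc ω ≤ j} ≤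
    μ.real {ω | (∀ m ∈ B, ω ∉ openConn x m) ∧ Nx ω ≤ j}
  -- on `Vx` (x joined to the glued set), `N_B ≥ 1` and the two events `{1 ≤ N_B ≤ j}`, `G_x` coincide
  have hV1 : ∀ ω ∈ Vx, 1 ≤ NB ω := by
    rintro ω ⟨m, hm, hxm⟩
    exact Finset.card_pos.2 ⟨x, Finset.mem_filter.2 ⟨hxA, m, hm, (show (openGraph ω).Reachable m x from
      (show (openGraph ω).Reachable x m from hxm).symm)⟩⟩
  have hsplitL := measureReal_inter_add_sdiff (μ := μ) (s := {ω : BondConfig (Fin n) | 1 ≤ NB ω ∧ NB ω ≤ j})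
    (MeasurableSet.of_discrete (s := Vx)) (measure_ne_top _ _)
  have hsplitG := measureReal_inter_add_sdiff (μ := μ) (s := Gx) (MeasurableSet.of_discrete (s := Vx)) (measure_ne_top _ _)
  have hsplitC := measureReal_inter_add_sdiff (μ := μ) (s := {ω : BondConfig (Fin n) | Nc ω ≤ j})
    (MeasurableSet.of_discrete (s := {ω : BondConfig (Fin n) | 1 ≤ NB ω})) (measure_ne_top _ _)
  have eV : {ω : BondConfig (Fin n) | 1 ≤ NB ω ∧ NB ω ≤ j} ∩ Vx = Gx ∩ Vx := by
    ext ω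
    simp only [hGx, mem_inter_iff, mem_setOf_eq]
    constructor
    · rintro ⟨⟨_, h2⟩, hV⟩
      refine ⟨⟨fun _ => h2, fun hno => ?_⟩, hV⟩
      obtain ⟨m, hm, hxm⟩ := hV; exact absurd hxm (hno m hm)
    · rintro ⟨⟨h1, _⟩, hV⟩
      exact ⟨⟨hV1 ω hV, h1 hV⟩, hV⟩
  have eL : {ω : BondConfig (Fin n) | 1 ≤ NB ω ∧ NB ω ≤ j} \ Vx = {ω | (∀ m ∈ B, ω ∉ openConn x m) ∧ 1 ≤ NB ω ∧ NB ω ≤ j} := by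
    ext ω
    simp only [hVx, mem_sdiff, mem_setOf_eq, not_exists, not_and]
    tauto
  have eG : Gx \ Vx = {ω | (∀ m ∈ B, ω ∉ openConn x m) ∧ Nx ω ≤ j} := by
    ext ω
    simp only [hGx, hVx, mem_sdiff, mem_setOf_eq, not_exists, not_and]
    constructor
    · rintro ⟨⟨_, h2⟩, hno⟩
      exact ⟨hno, h2 (fun m hm hxm => hno m hm hxm)⟩
    · rintro ⟨hno, h2⟩
      exact ⟨⟨fun ⟨m, hm, hxm⟩ => absurd hxm (hno m hm), fun _ => h2⟩, hno⟩
  have eC1 : {ω : BondConfig (Fin n) | Nc ω ≤ j} ∩ {ω | 1 ≤ NB ω} = {ω | Nc ω ≤ j ∧ 1 ≤ NB ω} := by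
    ext ω; simp only [mem_inter_iff, mem_setOf_eq]
  have eC2 : {ω : BondConfig (Fin n) | Nc ω ≤ j} \ {ω | 1 ≤ NB ω} = {ω | ¬ 1 ≤ NB ω ∧ Nc ω ≤ j} := by
    ext ω; simp only [mem_sdiff, mem_setOf_eq]; exact and_comm
  rw [eV, eL] at hsplitL
  rw [eG] at hsplitG
  rw [eC1, eC2] at hsplitC
  linarith

end Summit.CriticalPhenomena.PercolationContinuityZ3.Theorems

end
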